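import Summits.RiemannHypothesis.RiemannHypothesis.Theorems.Splittings.RobinFiniteKernelHeightFree
import Literature.NumberTheory.LFunctions.RiemannHypothesisUpTo100000X
import HarnessLib

/-!
# RobinFiniteKernelHeightClosure — COMPUTATIONAL CLOSURE: Robin's inequality for every `5040 < n ≤ 10^3845000` and Robin at every
# colossally abundant `N > 5040` with primes `≤ 8 886 113`, UNCONDITIONALLY, by discharging RH up to `10⁵` with the tree's certificate
# `riemannHypothesisUpTo_100000` (SPLIT-robin-finite gen 15, part 4/4; `--computational`: exactly RHT100000's `native_decide` companions)

Cell rh-split, card `cards/SPLIT-robin-finite.md` §22.  HONEST LABEL: «SPLITTING SEARCH over kernel-typed RH-EQUIVALENCES; a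
splitting A ∧ B ⟹ RH is CONDITIONAL bookkeeping unless A and B are both proved; nothing here bears on the truth of RH.»

Zero `def`, zero `sorry`, no `native_decide` IN THIS FILE; its two theorems discharge the only hypothesis `RiemannHypothesisUpTo 100000`
of part 3 (`robinCA_below_of_rhKernelFree`, `robin_le_of_rhKernelFree`: standard axioms, no print fact) by the tree's theorem
`riemannHypothesisUpTo_100000` (compiled Riemann–Siegel sign certificate, `RiemannHypothesisUpTo100000X`), and therefore inherit exactly that
certificate's `Lean.ofReduceBool`/`native_decide` companion axioms (precedent: gen 10 `RobinFiniteE1cUpperClosure`).  Tree comparison,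
kernel-checked at standard axioms: `robinCA_below_four_pow_eleven` (primes `< 4 194 304`) and `robinInequality_le_ten_pow_1958000`.
Nothing here bears on the truth of RH.
-/

set_option linter.dupNamespace false

noncomputable section

open Real Filter Finset
open scoped Chebyshev

namespace Summit.RiemannHypothesis.RiemannHypothesis.Theorems.Splittings.RobinFiniteC1

open Literature.NumberTheory.LFunctions Literature.NumberTheory.DiophantineGeometry
open RobinAnalyticSharp

section KernelHeightClosure

/-- **HEADLINE (g15, UNCONDITIONAL, computational class): Robin's inequality holds at every colossally abundant `N > 5040` all of whose
prime factors are `≤ 8 886 113`** — `robinCA_below_of_rhKernelFree` with RH up to `10⁵` DISCHARGED by the tree's `riemannHypothesisUpTo_100000`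
(tree at standard axioms: primes `< 4¹¹ = 4 194 304`, `robinCA_below_four_pow_eleven`; CA chain final prime `4 509 073`).  No print fact.
Nothing here bears on the truth of RH. -/
theorem robinCA_below_8886114 : robinCA_below 8886114 :=
  robinCA_below_of_rhKernelFree riemannHypothesisUpTo_100000

/-- **HEADLINE (g15, UNCONDITIONAL, computational class): `σ(n) < e^γ·n·log log n` for every `5040 < n ≤ 10^3845000`** —
`robin_le_of_rhKernelFree` with RH up to `10⁵` DISCHARGED by the tree's `riemannHypothesisUpTo_100000` (tree at standard axioms:
`n ≤ 10^1958000`, `robinInequality_le_ten_pow_1958000`; print: Briggs 2006 `n ≤ 10^(10^10)` by floating-point CA enumeration,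
Morrill–Platt 2021 `n ≤ 10^(10^13.1)`).  No print fact.  Nothing here bears on the truth of RH. -/
theorem robinInequality_le_ten_pow_3845000 : ∀ n : ℕ, 5040 < n → n ≤ 10 ^ 3845000 → robinInequality n :=
  robin_le_of_rhKernelFree riemannHypothesisUpTo_100000

end KernelHeightClosure

end Summit.RiemannHypothesis.RiemannHypothesis.Theorems.Splittings.RobinFiniteC1

end
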